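import Summits.SmoothPoincare4.SmoothPoincare4.Theorems.ConvexBisectionAcyclicBisectionExistsPrefixHandlebody
import Summits.SmoothPoincare4.SmoothPoincare4.Theorems.ConvexBisectionAcyclicBisectionExistsKasOpenBook
import Summits.SmoothPoincare4.SmoothPoincare4.Theorems.ConvexBisectionAcyclicBisectionExistsContactSignPropagation
import Literature.Geometry.Symplectic.LefschetzSteinRealisation
import Literature.Geometry.Symplectic.FoldFormsFourFoldsSteinGlue
import HarnessLib

/-!
# NF6 reduced to T3 + S2: `stub_steinRealisation` from the dual-presentation node and the named
# fact "PALF ⇒ Stein supported by the Kas open book"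
(registered sub-goal `helper_steinRealisation_of_nodes` of stub `stub_steinRealisation` (NF6), line
`modp-braid-orbits` r11, crux `ConvexBisection.AcyclicBisectionExists`, item stmt-SmoothPoincare4-10508;
wave 4, worker Y7, lead c5; tree port of the sorry-free assembly of the design file
`Cruxes/AcyclicBisectionExists/NF6_Assembly_Design.lean`, W7 wave 1)

The registered NF6 signature — verbatim the body of the named fact
`Literature.Geometry.Symplectic.steinRealisation_of_sorted_modelsOnFibred` (Baykur 2006, proof of
Thm. 5.1, pp. 13–14) — is PROVED here from exactly two hypotheses:

* **(T3)** the dual-presentation node `node_T3_dualPresentation` of the design (an `∀`-proposition,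
  topology only, being proved by the T3 bricks of waves 2–4): from `ModelsOnFibred M g (P ++ N)`
  with `N` negative and all classes non-zero — the model's link `h`, Baykur's `X₊ = X₁ = Base g ∪
  (prefix handles)` with data `D₁`, the complement piece `W₂` with `M = X₁ ∪_φ W₂`, a presentation
  `(h₂, D₂)` of `W₂` as a POSITIVE ALLOWABLE Lefschetz handlebody over the cap, the seam page
  function `F : ∂X₁ → ℂ` (a positive multiple of the page coordinate `w` of both presentations on
  their unsurgered parts, zeros only at unsurgered points, `d(arg F) ≠ 0` off the zeros), binding
  points unsurgered for the second presentation, one seam point with compatible positive boundary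
  frames (ORSEAM), and `∂X₁` connected; written against the landed vocabulary
  (`Literature.Geometry.Symplectic.IsPosBdryFrame`; the design's `cderiv F y v` spelled
  `@id ℂ (mfderiv (𝓡 3) 𝓘(ℝ, ℂ) F y v)` as in the landed node KOB);
* **(S2)** the named fact `Literature.Geometry.Symplectic.palf_stein_supportedByBoundaryOpenBook`
  (Akbulut–Ozbagci 2001 Thm. 5 + Gay 2002 Prop. 2.8; accepted Literature `def … : Prop`, p136168),

all other nodes of the design being discharged by LANDED helpers of this namespace:
T1 = `helper_isLefschetzHandlebody_of_split` (p136157, with p134450, p134021),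
KOB = `helper_kasOpenBook_of_seamFunction` (p137932), S3-orient = `helper_wedge_pos_iff_of_exists`
(p137223); the re-reading of the boundary datum `b₂` on `∂X₁` along `φ` is the tree's
`Literature.Geometry.Symplectic.reindexBoundaryData` (carrier `b₁.carrier`, inclusion `b₂.incl ∘ φ`).

* §1 `boundaryPlaneField_reindexBoundaryData` — chain rule: the NF6 plane field
  `y ↦ (boundaryPlaneField J b₂ (φ y)).comap dφ_y` IS `boundaryPlaneField J (reindexBoundaryData b₂ φ)`,
  so S2 applied on the re-indexed datum already yields the Giroux form of the registered conclusion;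
* §2 `isKasOpenBookOf_of_seamFunction` — an open book with binding `{F = 0}` and fibration `F/‖F‖`
  is the Kas open book (`IsKasOpenBookOf`) of ANY presentation for which `F` is a seam page function;
  hence the KOB open book of the `X₁`-presentation is the Kas open book of the `W₂`-presentation too;
* §3 `steinRealisation_of_nodes` — NF6 verbatim from (T3) and (S2): T1 gives
  `IsLefschetzHandlebody g P X₁`; S2 on the prefix presentation of `X₁` (positive and allowable by
  `IsLefschetzLink.prefix` and the hypotheses on `P`) and on the presentation of `W₂` read on
  `reindexBoundaryData b₂ φ` give `S₁, α₁` and `S₂, α₂` for the SAME open book, both positive at the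
  ORSEAM point; S3-orient propagates the sign over the connected seam;
  `steinRealisation_of_sorted_modelsOnFibred_of_nodes` — the same with the conclusion BY NAME
  (statement check), and the registered form `helper_steinRealisation_of_nodes`.

Everything here is proved; no definitions, no `sorry`; the only non-constructive inputs are the
two hypotheses.

## References
* R. İ. Baykur, *Kähler decomposition of 4-manifolds*, Algebr. Geom. Topol. 6 (2006), §2.3 and proof
  of Thm. 5.1, pp. 13–14. [Baykur2006]
* S. Akbulut, B. Ozbagci, *Lefschetz fibrations on compact Stein surfaces*, Geom. Topol. 5 (2001),
  Thm. 5. [AkbulutOzbagci2001]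
* D. T. Gay, *Explicit concave fillings of contact three-manifolds*, Math. Proc. Camb. Phil. Soc.
  133 (2002), Prop. 2.8. [Gay2002]
* J. B. Etnyre, *Lectures on open book decompositions and contact structures*, Clay Math. Proc. 5
  (2006), Thms. 5.4–5.6. [Etnyre2006]
* A. Kas, *On the handlebody decomposition associated to a Lefschetz fibration*, Pacific J. Math.
  89 (1980), 89–104. [Kas1980]
-/

noncomputable section

-- the prescribed namespace `Summit.<P>.<Sub>.…` duplicates `SmoothPoincare4` (P = Sub)
set_option linter.dupNamespace false

open scoped Manifold ContDiff Topology

namespace Summit.SmoothPoincare4.SmoothPoincare4.Theorems.AcyclicBisectionExists.ModpBraidOrbits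

open Set Function
open Literature.Topology.FourManifolds Literature.Topology.FourManifolds.HandleAttachingMap
  Literature.Topology.FourManifolds.LefschetzBase Literature.Geometry.Symplectic

/-! ## §1 The boundary plane field of a re-indexed boundary datum (chain rule) -/

/-- **Chain rule for the boundary plane field.**  For the boundary datum `b` of `W` re-read on a
`3`-manifold `N` along a diffeomorphism `e : N ≅ b.carrier` (`reindexBoundaryData b e`: carrier `N`,
inclusion `b.incl ∘ e`), the complex tangencies pulled back along `b.incl ∘ e` at `y` are those
pulled back along `b.incl` at `e y`, pulled back along `de_y`. [folklore] -/
theorem boundaryPlaneField_reindexBoundaryData {W : Type} [TopologicalSpace W]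
    [ChartedSpace (EuclideanHalfSpace 4) W] [IsManifold (𝓡∂ 4) ∞ W] [CompactSpace W] [T2Space W]
    (J : W → (EuclideanSpace ℝ (Fin 4) →L[ℝ] EuclideanSpace ℝ (Fin 4)))
    (b : BoundaryData (𝓡∂ 4) W (𝓡 3)) {N : Type} [TopologicalSpace N]
    [ChartedSpace (EuclideanSpace ℝ (Fin 3)) N] [IsManifold (𝓡 3) ∞ N]
    (e : N ≃ₘ⟮𝓡 3, 𝓡 3⟯ b.carrier) :
    (fun y => (boundaryPlaneField J b (e y)).comap (mfderiv (𝓡 3) (𝓡 3) e y).toLinearMap :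
        N → Submodule ℝ (EuclideanSpace ℝ (Fin 3))) =
      boundaryPlaneField J (reindexBoundaryData b e) := by
  funext y
  have hb : MDifferentiableAt (𝓡 3) (𝓡∂ 4) b.incl (e y) :=
    (b.isSmoothEmbedding.contMDiff (e y)).mdifferentiableAt (by simp)
  have he : MDifferentiableAt (𝓡 3) (𝓡 3) e y := (e.contMDiff y).mdifferentiableAt (by simp)
  have hcomp : mfderiv (𝓡 3) (𝓡∂ 4) (b.incl ∘ e) y =
      (mfderiv (𝓡 3) (𝓡∂ 4) b.incl (e y)).comp (mfderiv (𝓡 3) (𝓡 3) e y) := mfderiv_comp y hb he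
  ext v
  show mfderiv (𝓡 3) (𝓡∂ 4) b.incl (e y) (mfderiv (𝓡 3) (𝓡 3) e y v) ∈ contactPlane J (b.incl (e y)) ↔
    mfderiv (𝓡 3) (𝓡∂ 4) (b.incl ∘ e) y v ∈ contactPlane J (b.incl (e y))
  rw [hcomp]
  rfl

/-! ## §2 The Kas open book of a seam page function is the Kas open book of every presentation
for which it is a seam page function -/

/-- **Kas property from a seam page function.**  Let `X = Base g ∪_{h} (2-handles)` with data `D`
be read on a `3`-manifold `N` through `incl : N → X`, `F : N → ℂ` a positive multiple of `w(a)` at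
every unsurgered point `incl y = D.jA a` whose zeros are unsurgered points, and `ob` an open book on
`N` with binding `{F = 0}` and fibration `F/‖F‖` off it.  Then `ob` is the Kas boundary open book of
`(h, D)` read through `incl` (`IsKasOpenBookOf`: binding = image of the base binding `w = 0`,
fibration = page angle `w/‖w‖` at unsurgered points). [cite: Kas1980] -/
theorem isKasOpenBookOf_of_seamFunction {g : ℕ} {ι : Type} [Finite ι] {X : Type} [TopologicalSpace X]
    [ChartedSpace (EuclideanHalfSpace 4) X] (h : ι → HandleAttachingMap 3 2 (Base g))
    (D : MultiAttachmentData h (𝓡∂ 4) X) {N : Type} [TopologicalSpace N]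
    [ChartedSpace (EuclideanSpace ℝ (Fin 3)) N] [IsManifold (𝓡 3) ∞ N] (incl : N → X)
    (ob : OpenBook N) (F : N → ℂ)
    (hF : ∀ (y : N) (a : ↥(coresComplement h)), incl y = D.jA a →
      ∃ c : ℝ, 0 < c ∧ F y = c * w g (a : Base g).1)
    (hF0 : ∀ y : N, F y = 0 → ∃ a : ↥(coresComplement h), incl y = D.jA a)
    (hproj : ∀ y : N, F y ≠ 0 →
      toC ((ob.proj y : Metric.sphere (0 : EuclideanSpace ℝ (Fin 2)) 1) : EuclideanSpace ℝ (Fin 2)) =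
        F y / (‖F y‖ : ℂ))
    (hbind : ∀ y : N, y ∈ ob.binding ↔ F y = 0) :
    IsKasOpenBookOf g h D incl ob := by
  refine ⟨fun y => ⟨fun hy => ?_, ?_⟩, fun y a hy hw => ?_⟩
  · -- a binding point is an unsurgered point with `w = 0`
    have hFy : F y = 0 := (hbind y).1 hy
    obtain ⟨a, ha⟩ := hF0 y hFy
    obtain ⟨c, hc, hFc⟩ := hF y a ha
    refine ⟨a, ha, ?_⟩
    have h0 : (c : ℂ) * w g (a : Base g).1 = 0 := hFc ▸ hFy
    exact (mul_eq_zero.1 h0).resolve_left (by exact_mod_cast hc.ne')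
  · rintro ⟨a, ha, hw⟩
    obtain ⟨c, -, hFc⟩ := hF y a ha
    exact (hbind y).2 (by rw [hFc, hw, mul_zero])
  · obtain ⟨c, hc, hFc⟩ := hF y a hy
    have hc0 : (c : ℂ) ≠ 0 := by exact_mod_cast hc.ne'
    have hFy : F y ≠ 0 := by rw [hFc]; exact mul_ne_zero hc0 hw
    rw [hproj y hFy, hFc, norm_mul, Complex.norm_real, Real.norm_eq_abs, abs_of_pos hc,
      Complex.ofReal_mul, mul_div_mul_left _ _ hc0]

/-! ## §3 NF6 from (T3) and (S2) -/

/-- **NF6 = `Literature.Geometry.Symplectic.steinRealisation_of_sorted_modelsOnFibred` (signature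
verbatim the registered stub `stub_steinRealisation`) PROVED from the dual-presentation node (T3) and
the named fact (S2) `palf_stein_supportedByBoundaryOpenBook`** (Baykur 2006, proof of Thm. 5.1,
pp. 13–14).  Proof: (T3) gives `h, X₁, D₁, W₂, b₁, b₂, φ, h₂, D₂` and the seam page function `F`;
KOB (`helper_kasOpenBook_of_seamFunction`) gives the open book `ob` of `F` on `∂X₁`, the Kas open
book of the prefix presentation of `X₁`, and (`isKasOpenBookOf_of_seamFunction` with clauses
(ii)–(iii) of (T3)) of the presentation of `W₂` read through `b₂.incl ∘ φ`; T1
(`helper_isLefschetzHandlebody_of_split`) gives `IsLefschetzHandlebody g P X₁`; (S2) on the prefix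
presentation (positive and allowable: `IsLefschetzLink.prefix`, `hP`, `hnz`) gives `S₁, α₁`, and on
`(W₂, h₂, D₂, reindexBoundaryData b₂ φ, ob)` gives `S₂, α₂` — a Giroux form for the pulled-back plane
field by `boundaryPlaneField_reindexBoundaryData`; both are positive on the common frame of the
ORSEAM point, so S3-orient (`helper_wedge_pos_iff_of_exists`) on the connected seam gives the sign
clause. [cite: Baykur2006, Thm. 5.1 (proof, pp. 13–14)] -/
theorem steinRealisation_of_nodes
    (hT3 : ∀ (M : Type) [TopologicalSpace M] [T2Space M] [SecondCountableTopology M]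
      [ChartedSpace (EuclideanSpace ℝ (Fin 4)) M] [IsManifold (𝓡 4) ∞ M] (g : ℕ)
      (P N : List ((Fin g ⊕ Fin g → ℤ) × Bool)),
      ModelsOnFibred M g (P ++ N) → (∀ x ∈ N, x.2 = false) → (∀ x ∈ P ++ N, x.1 ≠ 0) →
      ∃ (h : Fin (P ++ N).length → HandleAttachingMap 3 2 (Base g))
        (X₁ : Type) (_ : TopologicalSpace X₁) (_ : T2Space X₁) (_ : SecondCountableTopology X₁)
        (_ : CompactSpace X₁) (_ : ChartedSpace (EuclideanHalfSpace 4) X₁)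
        (_ : IsManifold (𝓡∂ 4) ∞ X₁)
        (D₁ : MultiAttachmentData
          (fun i : Fin P.length => h (Fin.cast List.length_append.symm (Fin.castAdd N.length i)))
          (𝓡∂ 4) X₁)
        (W₂ : Type) (_ : TopologicalSpace W₂) (_ : ChartedSpace (EuclideanHalfSpace 4) W₂)
        (_ : IsManifold (𝓡∂ 4) ∞ W₂) (_ : CompactSpace W₂) (_ : T2Space W₂)
        (_ : SecondCountableTopology W₂)
        (b₁ : BoundaryData (𝓡∂ 4) X₁ (𝓡 3)) (b₂ : BoundaryData (𝓡∂ 4) W₂ (𝓡 3))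
        (φ : b₁.carrier ≃ₘ⟮𝓡 3, 𝓡 3⟯ b₂.carrier)
        (h₂ : Fin N.length → HandleAttachingMap 3 2 (Base g))
        (D₂ : MultiAttachmentData h₂ (𝓡∂ 4) W₂)
        (F : b₁.carrier → ℂ),
        IsLefschetzLink g (P ++ N) h ∧ IsBoundaryGluing b₁ b₂ φ (𝓡 4) M ∧
        (∀ j, ∃ c : ℂ, ‖c‖ = 1 ∧ ∀ θ, (h₂ j).attachingCircle θ ∈ page g c) ∧
        (∀ j, shadow g (h₂ j).attachingCircle (h₂ j).continuous_attachingCircle ≠ 0) ∧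
        (∀ j, pageTwisting g (h₂ j).attachingCircle (h₂ j).attachingFraming = -1) ∧
        ContMDiff (𝓡 3) 𝓘(ℝ, ℂ) ∞ F ∧
        (∀ y a, b₁.incl y = D₁.jA a → ∃ c : ℝ, 0 < c ∧ F y = c * w g a.1.1) ∧
        (∀ y a', b₂.incl (φ y) = D₂.jA a' → ∃ c : ℝ, 0 < c ∧ F y = c * w g a'.1.1) ∧
        (∀ y, F y = 0 → ∃ a, b₁.incl y = D₁.jA a) ∧
        (∀ y, F y ≠ 0 → ∃ v : EuclideanSpace ℝ (Fin 3),
          ((starRingEnd ℂ) (F y) * @id ℂ (mfderiv (𝓡 3) 𝓘(ℝ, ℂ) F y v)).im ≠ 0) ∧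
        (∀ y a, b₁.incl y = D₁.jA a → w g a.1.1 = 0 → ∃ a', b₂.incl (φ y) = D₂.jA a') ∧
        (∃ (y : b₁.carrier)
            (a₁ : coresComplement fun i : Fin P.length =>
              h (Fin.cast List.length_append.symm (Fin.castAdd N.length i)))
            (a₂ : coresComplement h₂)
            (uu : Fin 3 → EuclideanSpace ℝ (Fin 3)) (v₁ v₂ : Fin 3 → EuclideanSpace ℝ (Fin 4)),
          b₁.incl y = D₁.jA a₁ ∧ b₂.incl (φ y) = D₂.jA a₂ ∧
          (∀ k, mfderiv (𝓡 3) (𝓡∂ 4) b₁.incl y (uu k) = mfderiv (𝓡∂ 4) (𝓡∂ 4) D₁.jA a₁ (v₁ k)) ∧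
          (∀ k, mfderiv (𝓡 3) (𝓡∂ 4) (b₂.incl ∘ φ) y (uu k) =
            mfderiv (𝓡∂ 4) (𝓡∂ 4) D₂.jA a₂ (v₂ k)) ∧
          IsPosBdryFrame
            (fun i : Fin P.length => h (Fin.cast List.length_append.symm (Fin.castAdd N.length i)))
            a₁ v₁ ∧ IsPosBdryFrame h₂ a₂ v₂) ∧
        ConnectedSpace b₁.carrier)
    (hS2 : palf_stein_supportedByBoundaryOpenBook) :
    ∀ (M : Type) [TopologicalSpace M] [T2Space M] [SecondCountableTopology M]
      [ChartedSpace (EuclideanSpace ℝ (Fin 4)) M] [IsManifold (𝓡 4) ∞ M] (g : ℕ)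
      (P N : List ((Fin g ⊕ Fin g → ℤ) × Bool)),
      ModelsOnFibred M g (P ++ N) → (∀ x ∈ P, x.2 = true) → (∀ x ∈ N, x.2 = false) →
      (∀ x ∈ P ++ N, x.1 ≠ 0) →
      ∃ (W₁ : Type) (_ : TopologicalSpace W₁) (_ : ChartedSpace (EuclideanHalfSpace 4) W₁)
        (_ : IsManifold (𝓡∂ 4) ∞ W₁) (_ : CompactSpace W₁) (_ : T2Space W₁)
        (_ : SecondCountableTopology W₁)
        (W₂ : Type) (_ : TopologicalSpace W₂) (_ : ChartedSpace (EuclideanHalfSpace 4) W₂)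
        (_ : IsManifold (𝓡∂ 4) ∞ W₂) (_ : CompactSpace W₂)
        (S₁ : SteinStructure W₁) (S₂ : SteinStructure W₂)
        (b₁ : BoundaryData (𝓡∂ 4) W₁ (𝓡 3)) (b₂ : BoundaryData (𝓡∂ 4) W₂ (𝓡 3))
        (φ : b₁.carrier ≃ₘ⟮𝓡 3, 𝓡 3⟯ b₂.carrier)
        (ob : OpenBook b₁.carrier)
        (α₁ α₂ : Literature.Geometry.Kaehler.MForm (𝓡 3) b₁.carrier ℝ 1),
        IsBoundaryGluing b₁ b₂ φ (𝓡 4) M ∧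
        ob.IsGirouxForm (boundaryPlaneField S₁.J b₁) α₁ ∧
        ob.IsGirouxForm (fun y => (boundaryPlaneField S₂.J b₂ (φ y)).comap
          (mfderiv (𝓡 3) (𝓡 3) φ y).toLinearMap) α₂ ∧
        (∀ y u v w, 0 < wedge₁₂ (α₁ y) (Literature.Geometry.Kaehler.mextDeriv α₁ y) u v w ↔
          0 < wedge₁₂ (α₂ y) (Literature.Geometry.Kaehler.mextDeriv α₂ y) u v w) ∧
        IsLefschetzHandlebody g P W₁ := by
  intro M _ _ _ _ _ g P N hM hP hN hnz
  -- (T3): the dual presentation of the complement piece and the seam page function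
  obtain ⟨h, X₁, _, _, _, _, _, _, D₁, W₂, _, _, _, _, _, _, b₁, b₂, φ, h₂, D₂, F, hlink, hglue,
    hpage₂, hsh₂, htw₂, hFs, hF₁, hF₂, hF0, hFd, hbind, hseam, hconn⟩ := hT3 M g P N hM hN hnz
  -- the prefix presentation of `X₁` is positive and allowable
  obtain ⟨-, hpage₁, hsh₁, htw₁⟩ := IsLefschetzLink.prefix hlink
  have hpages₁ : ∀ i : Fin P.length, ∃ c : ℂ, ‖c‖ = 1 ∧ ∀ θ,
      (h (Fin.cast List.length_append.symm (Fin.castAdd N.length i))).attachingCircle θ ∈ page g c :=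
    fun i => ⟨_, norm_pageDir _ _, hpage₁ i⟩
  have hshadow₁ : ∀ i : Fin P.length,
      shadow g (h (Fin.cast List.length_append.symm (Fin.castAdd N.length i))).attachingCircle
        (h (Fin.cast List.length_append.symm (Fin.castAdd N.length i))).continuous_attachingCircle ≠
        0 := fun i => by
    rw [hsh₁ i]
    exact hnz _ (List.mem_append_left _ (List.get_mem P i))
  have htwist₁ : ∀ i : Fin P.length,
      pageTwisting g (h (Fin.cast List.length_append.symm (Fin.castAdd N.length i))).attachingCircle
        (h (Fin.cast List.length_append.symm (Fin.castAdd N.length i))).attachingFraming = -1 :=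
    fun i => by
    rw [htw₁ i, hP _ (List.get_mem P i)]
    rfl
  -- KOB: the open book of `F`, the Kas open book of the prefix presentation of `X₁` …
  obtain ⟨ob, hkas₁, hproj, hbindF⟩ :=
    helper_kasOpenBook_of_seamFunction g (Fin P.length) X₁
      (fun i : Fin P.length => h (Fin.cast List.length_append.symm (Fin.castAdd N.length i))) D₁ b₁ F
      hpages₁ hFs hF₁ hF0 hFd
  -- … and of the presentation of `W₂` read through `b₂.incl ∘ φ`
  have hkas₂ : IsKasOpenBookOf g h₂ D₂ (b₂.incl ∘ φ) ob := by
    refine isKasOpenBookOf_of_seamFunction h₂ D₂ (b₂.incl ∘ φ) ob F hF₂ (fun y hFy => ?_) hproj hbindF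
    -- a zero of `F` is `X₁`-unsurgered with `w = 0`, hence `W₂`-unsurgered
    obtain ⟨a, ha⟩ := hF0 y hFy
    obtain ⟨c, hc, hFc⟩ := hF₁ y a ha
    have h0 : (c : ℂ) * w g (a : Base g).1 = 0 := hFc ▸ hFy
    exact hbind y a ha ((mul_eq_zero.1 h0).resolve_left (by exact_mod_cast hc.ne'))
  -- T1: `X₁ = X(F; P)` after rotating the pages
  have hLH : IsLefschetzHandlebody g P X₁ :=
    helper_isLefschetzHandlebody_of_split g P N h X₁ hlink D₁.isMultiAttachment
  -- (S2) for the prefix presentation of `X₁`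
  obtain ⟨S₁, α₁, hG₁, hO₁⟩ :=
    hS2 g (Fin P.length) X₁
      (fun i : Fin P.length => h (Fin.cast List.length_append.symm (Fin.castAdd N.length i))) D₁ b₁
      ob hpages₁ hshadow₁ htwist₁ hkas₁
  -- (S2) for the presentation of `W₂`, read on the re-indexed boundary datum (carrier `∂X₁`)
  obtain ⟨S₂, α₂, hG₂', hO₂⟩ :=
    hS2 g (Fin N.length) W₂ h₂ D₂ (reindexBoundaryData b₂ φ) ob hpage₂ hsh₂ htw₂ hkas₂
  have hG₂ : ob.IsGirouxForm (fun y => (boundaryPlaneField S₂.J b₂ (φ y)).comap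
      (mfderiv (𝓡 3) (𝓡 3) φ y).toLinearMap) α₂ := by
    rw [boundaryPlaneField_reindexBoundaryData S₂.J b₂ φ]
    exact hG₂'
  -- the sign clause: S3-orient at the ORSEAM point
  have hsign : ∀ y u v w, 0 < wedge₁₂ (α₁ y) (Literature.Geometry.Kaehler.mextDeriv α₁ y) u v w ↔
      0 < wedge₁₂ (α₂ y) (Literature.Geometry.Kaehler.mextDeriv α₂ y) u v w := by
    obtain ⟨y, a₁, a₂, uu, v₁, v₂, hy₁, hy₂, hu₁, hu₂, hpos₁, hpos₂⟩ := hseam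
    exact helper_wedge_pos_iff_of_exists b₁.carrier α₁ α₂ hG₁.smooth hG₂.smooth hG₁.contact
      hG₂.contact ⟨y, uu 0, uu 1, uu 2, hO₁ y a₁ uu v₁ hy₁ hu₁ hpos₁, hO₂ y a₂ uu v₂ hy₂ hu₂ hpos₂⟩
  exact ⟨X₁, inferInstance, inferInstance, inferInstance, inferInstance, inferInstance, inferInstance,
    W₂, inferInstance, inferInstance, inferInstance, inferInstance, S₁, S₂, b₁, b₂, φ, ob, α₁, α₂,
    hglue, hG₁, hG₂, hsign, hLH⟩

/-! ## §4 The registered form -/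

/-- **Registered sub-goal `helper_steinRealisation_of_nodes` of stub `stub_steinRealisation` (NF6 ▸
T3 + S2; wave 4, lead c5): the named fact NF6
`Literature.Geometry.Symplectic.steinRealisation_of_sorted_modelsOnFibred` BY NAME from the
dual-presentation node (T3, fully qualified `∀`-text, to be registered as `stub_T3`) and the named
fact (S2) `Literature.Geometry.Symplectic.palf_stein_supportedByBoundaryOpenBook`** — the statement
check that `steinRealisation_of_nodes` proves literally the unfolding of the Literature `def`.
[cite: Baykur2006, Thm. 5.1 (proof, pp. 13–14)] -/
theorem helper_steinRealisation_of_nodes : (∀ (M : Type) [TopologicalSpace M] [T2Space M] [SecondCountableTopology M] [ChartedSpace (EuclideanSpace ℝ (Fin 4)) M] [IsManifold (𝓡 4) ∞ M] (g : ℕ) (P N : List ((Fin g ⊕ Fin g → ℤ) × Bool)), Literature.Topology.FourManifolds.LefschetzBase.ModelsOnFibred M g (P ++ N) → (∀ x ∈ N, x.2 = false) → (∀ x ∈ P ++ N, x.1 ≠ 0) → ∃ (h : Fin (P ++ N).length → Literature.Topology.FourManifolds.HandleAttachingMap 3 2 (Literature.Topology.FourManifolds.LefschetzBase.Base g)) (X₁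 : Type) (_ : TopologicalSpace X₁) (_ : T2Space X₁) (_ : SecondCountableTopology X₁) (_ : CompactSpace X₁) (_ : ChartedSpace (EuclideanHalfSpace 4) X₁) (_ : IsManifold (𝓡∂ 4) ∞ X₁) (D₁ : Literature.Topology.FourManifolds.HandleAttachingMap.MultiAttachmentData (fun i : Fin P.length => h (Fin.cast List.length_append.symm (Fin.castAdd N.length i))) (𝓡∂ 4) X₁) (W₂ : Type) (_ : TopologicalSpace W₂) (_ : ChartedSpace (EuclideanHalfSpace 4) W₂) (_ : IsManifold (𝓡∂ 4) ∞ W₂) (_ : CompactSpace W₂) (_ : T2Space W₂) (_ : SecondCountableTopology W₂) (b₁ : Literature.Topology.FourManifolds.BoundaryData (𝓡∂ 4) X₁ (𝓡 3)) (b₂ : Literature.Topology.FourManifolds.BoundaryData (𝓡∂ 4) W₂ (𝓡 3)) (φ : b₁.carrier ≃ₘ⟮𝓡 3, 𝓡 3⟯ b₂.carrier) (h₂ : Fin N.length → Literature.Topology.FourManifolds.HandleAttachingMap 3 2 (Literature.Topology.FourManifolds.LefschetzBase.Base g)) (D₂ : Literature.Topology.FourManifolds.HandleAttachingMap.MultiAttachmentData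 h₂ (𝓡∂ 4) W₂) (F : b₁.carrier → ℂ), Literature.Topology.FourManifolds.LefschetzBase.IsLefschetzLink g (P ++ N) h ∧ Literature.Topology.FourManifolds.IsBoundaryGluing b₁ b₂ φ (𝓡 4) M ∧ (∀ j, ∃ c : ℂ, ‖c‖ = 1 ∧ ∀ θ, (h₂ j).attachingCircle θ ∈ Literature.Topology.FourManifolds.LefschetzBase.page g c) ∧ (∀ j, Literature.Topology.FourManifolds.LefschetzBase.shadow g (h₂ j).attachingCircle (h₂ j).continuous_attachingCircle ≠ 0) ∧ (∀ j, Literature.Topology.FourManifolds.LefschetzBase.pageTwisting g (h₂ j).attachingCircle (h₂ j).attachingFraming = -1) ∧ ContMDiff (𝓡 3) 𝓘(ℝ, ℂ) ∞ F ∧ (∀ y a, b₁.incl y = D₁.jA a → ∃ c : ℝ, 0 < c ∧ F y = c * Literature.Topology.FourManifolds.LefschetzBase.w g a.1.1) ∧ (∀ y a', b₂.incl (φ y) = D₂.jA a' → ∃ c : ℝ, 0 < c ∧ F y = c * Literature.Topology.FourManifolds.LefschetzBase.w g a'.1.1) ∧ (∀ y, F y = 0 → ∃ a, b₁.incl y =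 D₁.jA a) ∧ (∀ y, F y ≠ 0 → ∃ v : EuclideanSpace ℝ (Fin 3), ((starRingEnd ℂ) (F y) * @id ℂ (mfderiv (𝓡 3) 𝓘(ℝ, ℂ) F y v)).im ≠ 0) ∧ (∀ y a, b₁.incl y = D₁.jA a → Literature.Topology.FourManifolds.LefschetzBase.w g a.1.1 = 0 → ∃ a', b₂.incl (φ y) = D₂.jA a') ∧ (∃ (y : b₁.carrier) (a₁ : Literature.Topology.FourManifolds.HandleAttachingMap.coresComplement (fun i : Fin P.length => h (Fin.cast List.length_append.symm (Fin.castAdd N.length i)))) (a₂ : Literature.Topology.FourManifolds.HandleAttachingMap.coresComplement h₂) (uu : Fin 3 → EuclideanSpace ℝ (Fin 3)) (v₁ v₂ : Fin 3 → EuclideanSpace ℝ (Fin 4)), b₁.incl y = D₁.jA a₁ ∧ b₂.incl (φ y) = D₂.jA a₂ ∧ (∀ k, mfderiv (𝓡 3) (𝓡∂ 4) b₁.incl y (uu k) = mfderiv (𝓡∂ 4) (𝓡∂ 4) D₁.jA a₁ (v₁ k)) ∧ (∀ k, mfderiv (𝓡 3) (𝓡∂ 4) (b₂.incl ∘ φ)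 y (uu k) = mfderiv (𝓡∂ 4) (𝓡∂ 4) D₂.jA a₂ (v₂ k)) ∧ Literature.Geometry.Symplectic.IsPosBdryFrame (fun i : Fin P.length => h (Fin.cast List.length_append.symm (Fin.castAdd N.length i))) a₁ v₁ ∧ Literature.Geometry.Symplectic.IsPosBdryFrame h₂ a₂ v₂) ∧ ConnectedSpace b₁.carrier) → Literature.Geometry.Symplectic.palf_stein_supportedByBoundaryOpenBook → Literature.Geometry.Symplectic.steinRealisation_of_sorted_modelsOnFibred :=
  fun hT3 hS2 => steinRealisation_of_nodes hT3 hS2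

end Summit.SmoothPoincare4.SmoothPoincare4.Theorems.AcyclicBisectionExists.ModpBraidOrbits

end
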